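import Literature.MathematicalPhysics.QuantumFieldTheory.Balaban1983to89.B16NodeKnitRecord13CoPH
import Summits.QuantumFields.YangMills.Theorems.BalabanUVNodesN13AERowOfAveragedGibbsMeasureBoundAtRecord13SepCoPH

/-!
# BalabanUVNodes ∕ N13 — N13's DAG NODE `Dag.B16_main (leavesP w P)` AT A WORLD BOUND TO THE REVISED RECORD DATUM `datumOfRecord₁₃SepCoPHV θ h v` (the (δⱽ) version slot's teeth
# for stub 1's `RecordS` world): the node ⟸ (R₁₃) + (0.1) pointwise on the REVISED densities `v.ρ`; ⟸ `B16.Cor3With (datumⱽ v).C γ₁ w.em w.ep`; the slot letter's body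
# `B16.EndStatementBPrinted (datumⱽ v).C` yields the world letters; END-TO-END from Theorem 1 + the level-0 row + ONE measure inequality + the a.e. (Lˢ) half
# (Track A, DAG node N13 = [B16]; cluster K1 — K1⁸ `StabilityBRunRowsAtRecordR13SepCoPH` = stmt-QuantumFields-26907 (K1⁹ `…V` in plan g85's certified rev-28 kit), helper; seat
# `pub-ymgap-dag-n13-w3` g4, sequel of p621736 ∕ p622818; consumes DEF-1's p620607, n13-a's module 13 `B16NodeKnitRepTowerOfRecord`, `B16NodeKnitRecord13CoPH` by name; 2026-08-28; count-neutral)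

HONEST FRAMING.  Count-neutral BY-NAME KNIT; nothing of Bałaban's is asserted or refuted.  Director-ym №210 ∕ plan g84 WORD-3b ∕ plan g85 SHAPE-SHEET-REV28 (INBOX l.35472): the (B)
conjunct of K1 is re-displayed through a VERSION SLOT `v : Node00.Revision₁₃ F 2 θ h` at `datumOfRecord₁₃SepCoPHV F 2 θ h v` (DEF-1 p620607); the K1 «v8» skeleton uses the slot
trivially, «the slot's teeth = … inside stub 2″'s `RecordS` world, K1∕N13 lanes» — i.e. once the stub's world binds `w.C = (datumOfRecord₁₃SepCoPHV F 2 θ h v).C`, the N13 entry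
`Dag.B16_main (leavesP w P)` of `Nodes (leavesP w P)` must be knitted AT THE REVISED DENSITIES `v.ρ`.  Every N13 knit in the tree is keyed `w.C = (datumOfRecord₁₃CoPH θ h).C`
(`B16NodeKnitRecord13CoPH.b16_main_at_record₁₃CoPH` and this seat's p604459 ∕ p610463 ∕ p618747); THIS FILE supplies the revised-world knit, by name over n13-a's GENERIC module 13
(`B16NodeKnitRepTowerOfRecord.uvBounds_iff_construction` ∕ `uvSlot_at_construction` at ANY density family) and DEF-1's `rfl` face `datumOfRecord₁₃SepCoPHV_C`:
* §1 `uvBounds_iff_revision₁₃` — for `w.C = (datumⱽ v).C`: `(leavesP w P).uvBounds ↔` (0.1) two-sided POINTWISE on `v.ρ P k` in record letters (`χ_k = chiβOfRecord₁₃`, `A^η_k = wilsonBGOfRecord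
  … θ.εbg`, `g_k = gOfRecord₁₃`, `e± = w.em ∕ w.ep`); `uvIneq_revision₁₃_iff` — `B16.UVIneq ((datumⱽ v).C P) k U Em Ep ↔` the record-letter pair on `v.ρ` (`Iff.rfl`); `smallCouplings_iff_revision₁₃`.
* §2 ★★★ `b16_main_at_recordV₁₃_of_uvRowV` — `hC : w.C = (datumⱽ v).C`, `hup : w.up P = upOfRecord₅C F N (θ.toStage5₁₃CoPH F N) P`, (R₁₃) `hR13 : ∀ k < P.K, TLaw₁₃CoPH → SLaw₁₃CoPH (k+1)`
  (the 𝐑-leaf reads `w.up` only — `rOperation_iff_laws₁₃CoPH` — hence is VERSION-FREE), `w.γ ≤ γ₁`, and the (UV) row on `v.ρ` below `γ₁` at `SLaw`-levels ⟹ `Dag.B16_main (leavesP w P)`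
  (`b16_main_of_rOperation_of_uvSlot` ∘ `uvSlot_at_construction` at `M := coreOfRecord₁₃CoPH θ`, `ρ := v.ρ`, trivial representation, `Laws k _ := SLaw₁₃CoPH θ P k`, `sect2Form_coreOfRecord₁₃CoPH_iff`).
* §3 ★★★ `b16_main_at_recordV₁₃_of_cor3With` — `B16.Cor3With (datumⱽ v).C γ₁ w.em w.ep` + the bindings + (R₁₃) + `w.γ ≤ γ₁` ⟹ node; ★★★ `exists_letters_b16_main_at_recordV₁₃_of_endStatementBPrinted`
  — the SLOT LETTER's body `B16.EndStatementBPrinted (datumⱽ v).C` ⟹ `∃ γ₁ > 0, ∃ em ep, ∀ w P`, bindings + (R₁₃) + «`w.γ ≤ γ₁`, `w.em = em`, `w.ep = ep`» → node: the form a stub-1 engine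
  consumes when it builds the world's letters from the slot witness.
* §4 ★★★ `exists_revision₁₃_letters_b16_main_of_thm1_of_row0_of_towerMeasureUV_of_aeLowerSmall` — END-TO-END on this seat's measure road (p622818 §3 ∘ §3): Theorem 1 at the datum + the
  level-0 row + the selector laws (i)(ii) + ONE MEASURE INEQUALITY «`(π_{k+1})_*(ρ₀·dU_0) ≤ e^{ep(g_{k+1})|T₁^{(k+1)}|}·Haar_{k+1}`» on the γ-window + the a.e. (Lˢ) half + `εreg` range ⟹
  `∃ v γ₁ em′ ep′`, N13's node at EVERY (R₁₃)-world bound to `datumOfRecord₁₃SepCoPHV θ h v` with those letters.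
* §5 ★★★ `nodes_update_uvBounds` (ONLY `B16_main` reads `uvBounds` — kernel census by `rfl`) and `nodes_at_recordV₁₃_of_nodes_rebound_of_b16` ∕ `_of_cor3With`: ALL THIRTEEN nodes at the revised
  world ⟸ the thirteen at the SAME world re-bound to the record datum (any proof) + N13 there (§2–§3) — re-cutting stub 1's world to the slot costs exactly one node.
DOOR (consistency, `rfl`): at `v := Revision₁₃.refl θ h` the revised datum IS the record datum (`datumOfRecord₁₃SepCoPHV_refl`), so §2 specialises to `b16_main_at_record₁₃CoPH`.
WHAT IS DISPLAYED (LOCATED, by name): the (UV) row on `v.ρ` ∕ `Cor3With` ∕ the slot letter are HYPOTHESES — their suppliers are the slot chain (n13-w1 p620313 ∕ (3a) p622796, n13-w2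
p619268 ∕ p621421, this seat p621736 ∕ p622818) from Theorem 1 + VERSION-FREE rows, whose one open analytic entry at levels ≥ 1 is (2.50) (a.e. ∕ measure) — Bałaban's theorem proper
at the tree's selector laws; (R₁₃) is N13's own 𝐑-leaf (N11∕def-T rows).  N13 NOT discharged (a node at a revised world under displayed hypotheses is bookkeeping); K1⁸∕K1⁹ NEITHER proved
NOR refuted; no stub closed; no route text touched; counts unmoved (typed 28∕28 · discharged 5∕27 · Track A 5∕28).  ONE finite four-torus programme at fixed `ε = L^{−K}`, Bałaban AS
PRINTED; R4 closes the conditional finite-𝕋⁴ rung `BalabanLadder.UV` only — the Yang–Mills mass gap (Clay) is NOT proved by any of this; nothing continuum ∕ ℝ⁴ ∕ OS.  No `sorry`, `def`,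
`instance`, `notation`.

Sources: [Balaban1989LargeFieldII] Thm 1 p.355, (0.1) pp.355–356, p.387, p.391; [Balaban1988Convergent] p.244, (2.18) p.257, Thm 1 p.262, Thm 2 p.263, (2.49)–(2.50) p.264;
[Balaban1989LargeFieldI] (0.2)–(0.4) p.176, (i)–(ii) p.177.
-/

noncomputable section

open MeasureTheory
open scoped BigOperators ENNReal Matrix.Norms.L2Operator

namespace Summit.QuantumFields.YangMills.BalabanUVNodes.N13NodeAtRevisedRecordWorldAtRecord13SepCoPHV

open Literature.MathematicalPhysics.QuantumFieldTheory.Balaban1983to89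
open T4Continuum Node00 B14.Eq218Concrete DagBinding T4DatumAssembly FlowStepRuns
open B16NodeKnitRepTowerOfRecord (uvBounds_iff_construction uvSlot_at_construction smallCouplings_iff_genFlow_construction)
open B16NodeKnitRecord5 (b16_main_of_rOperation_of_uvSlot)
open B16NodeKnitRecord13CoPH (rOperation_iff_laws₁₃CoPH)

variable (F : T4Family) (N : ℕ) [NeZero N]

/-! ## §1. The leaves' N13 slots at a world bound to the REVISED record datum, unfolded on `v.ρ` -/

section Unfold

variable (θ : Stage13HParams F N) (h : θ.Provisos₁₃SepCoPH F N) (v : Revision₁₃ F N θ h) (w : WorldP) (P : B12.RunParams)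

/-- **N13's CONCLUSION `uvBounds` AT A REVISED-RECORD WORLD IS (0.1) POINTWISE ON THE REVISED DENSITIES**: for `w.C = (datumOfRecord₁₃SepCoPHV F N θ h v).C`, `(leavesP w P).uvBounds` IS
«for every `k ≤ K` and every `U`: `χ_k(U)·exp[−A^η_k(U)∕g_k² − w.em(g_k)·|T₁^{(k)}|] ≤ v.ρ P k U ≤ exp[w.ep(g_k)·|T₁^{(k)}|]`» with the record's `χ_k`, `A^η_k`, `g_k` (the slot re-chooses
the densities ONLY: `datumOfRecord₁₃SepCoPHV_C`, `rfl`) — module 13's `uvBounds_iff_construction` at `ρ := v.ρ`. [cite: Balaban1989LargeFieldII, (0.1) pp.355–356; Balaban1988Convergent, Cor. 3 (2.50) p.264 (bookkeeping)] -/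
theorem uvBounds_iff_revision₁₃ (hC : w.C = (datumOfRecord₁₃SepCoPHV F N θ h v).C) :
    (leavesP w P).uvBounds ↔
      ∀ k, k ≤ P.K → ∀ U : GaugeField (F.P P.K) k (SU N),
        chiβOfRecord₁₃ F N θ.toStage13Params P.K (gOfRecord₁₃ F N θ.toStage13Params P) k U *
              Real.exp (-(1 / (gOfRecord₁₃ F N θ.toStage13Params P k) ^ 2 * wilsonBGOfRecord F N θ.εbg P k U)
                - w.em (gOfRecord₁₃ F N θ.toStage13Params P k) * (Fintype.card (Site (F.P P.K) k) : ℝ)) ≤ v.ρ P k U ∧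
        v.ρ P k U ≤ Real.exp (w.ep (gOfRecord₁₃ F N θ.toStage13Params P k) * (Fintype.card (Site (F.P P.K) k) : ℝ)) :=
  uvBounds_iff_construction F N (coreOfRecord₁₃CoPH F N θ) v.ρ w P (hC.trans (datumOfRecord₁₃SepCoPHV_C F N θ h v))

/-- `B16.UVIneq` at the revised construction IS the record-letter pair on `v.ρ` (`Iff.rfl`). [cite: Balaban1989LargeFieldII, (0.1) pp.355–356 (bookkeeping)] -/
theorem uvIneq_revision₁₃_iff (k : ℕ) (U : GaugeField (F.P P.K) k (SU N)) (Em Ep : ℝ) :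
    B16.UVIneq ((datumOfRecord₁₃SepCoPHV F N θ h v).C P) k U Em Ep ↔
      chiβOfRecord₁₃ F N θ.toStage13Params P.K (gOfRecord₁₃ F N θ.toStage13Params P) k U *
            Real.exp (-(1 / (gOfRecord₁₃ F N θ.toStage13Params P k) ^ 2 * wilsonBGOfRecord F N θ.εbg P k U) - Em * (Fintype.card (Site (F.P P.K) k) : ℝ)) ≤ v.ρ P k U ∧
        v.ρ P k U ≤ Real.exp (Ep * (Fintype.card (Site (F.P P.K) k) : ℝ)) :=
  Iff.rfl

/-- The interval hypothesis at the revised-record world reads the forward-generated flow of record (the slot does not touch `βfun`; `rfl`). [cite: Balaban1987RG1, (0.17)–(0.20) pp.255–256 (bookkeeping)] -/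
theorem smallCouplings_iff_revision₁₃ (hC : w.C = (datumOfRecord₁₃SepCoPHV F N θ h v).C) :
    (leavesP w P).smallCouplings ↔ (genFlow (betaOfRecord₁₃ F N θ.toStage13Params) P.g0).InInterval w.γ P.K :=
  smallCouplings_iff_genFlow_construction F N (coreOfRecord₁₃CoPH F N θ) v.ρ w P (hC.trans (datumOfRecord₁₃SepCoPHV_C F N θ h v))

/-- The run's flow at the revised datum IS the forward-generated flow of record (`rfl`). [cite: Balaban1987RG1, (0.17)–(0.20) pp.255–256 (bookkeeping)] -/
theorem flow_inInterval_revision₁₃_iff (γ : ℝ) :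
    ((datumOfRecord₁₃SepCoPHV F N θ h v).C P).flow.InInterval γ P.K ↔ (genFlow (betaOfRecord₁₃ F N θ.toStage13Params) P.g0).InInterval γ P.K :=
  Iff.rfl


/-- **EVERY LEAF EXCEPT `uvBounds` IS VERSION-BLIND** (`rfl` after `subst`): at a world bound to the revised datum, the run's leaf values ARE those of the same world re-bound to the record
datum `datumOfRecord₁₃SepCoPH θ h`, with ONLY the `uvBounds` slot replaced (the construction's `flow`, `Sect2Form`, `IndAss`, `Cfg` do not read `ρ`; the ten in-edge leaves and the two
𝐑-leaves read `w.up`).  So a stub-1 engine re-cut to the slot re-proves N13 alone (§2–§4); the other twelve node predicates transfer by this identity insofar as they do not read `uvBounds`.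
[cite: Balaban1989LargeFieldII, Thm 1 p.355 (bookkeeping); Balaban1988Convergent, (0.2) p.244 (bookkeeping)] -/
theorem leavesP_revision₁₃_eq_update (hC : w.C = (datumOfRecord₁₃SepCoPHV F N θ h v).C) :
    leavesP w P = { leavesP { w with C := (datumOfRecord₁₃SepCoPH F N θ h).C } P with uvBounds := (leavesP w P).uvBounds } := by
  obtain ⟨C, up, γ, L, b, βup, β₀, gR, em, ep⟩ := w
  cases hC
  rfl

end Unfold

/-! ## §2. ★★★ N13's node at a world bound to the revised record datum from (R₁₃) + the (UV) row on the revised densities -/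

section Node

variable (θ : Stage13HParams F N) (h : θ.Provisos₁₃SepCoPH F N) (v : Revision₁₃ F N θ h) (w : WorldP) (P : B12.RunParams)

/-- **★★★ N13 AT THE REVISED-RECORD WORLD.**  For `w.C = (datumOfRecord₁₃SepCoPHV F N θ h v).C` and `w.up P = upOfRecord₅C F N (θ.toStage5₁₃CoPH F N) P`: `Dag.B16_main (leavesP w P)` from N13's two
own products — **(R₁₃)** `hR13 : ∀ k < P.K, TLaw₁₃CoPH F N θ P k → SLaw₁₃CoPH F N θ P (k+1)` (the 𝐑-leaf reads `w.up` ONLY: `rOperation_iff_laws₁₃CoPH`; version-free) and **(UVⱽ)** `hUVV`: (0.1)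
pointwise ON THE REVISED DENSITIES `v.ρ P k` at `SLaw`-levels, below `γ₁ ≥ w.γ` — what the slot witness carries by construction.  By name: `b16_main_of_rOperation_of_uvSlot` ∘ module 13's
`uvSlot_at_construction` at `M := coreOfRecord₁₃CoPH θ`, `ρ := v.ρ`, the trivial representation (`Rep := Unit`, `eval k _ := v.ρ P k`), `Laws k _ := SLaw₁₃CoPH θ P k` (`sect2Form_coreOfRecord₁₃CoPH_iff`).
At `v := Revision₁₃.refl θ h` this IS `b16_main_at_record₁₃CoPH` (`datumOfRecord₁₃SepCoPHV_refl`).  HYPOTHESES displayed; N13 NOT discharged; count-neutral.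
[cite: Balaban1989LargeFieldII, Thm 1 p.355, (0.1) pp.355–356, p.387, p.391; Balaban1988Convergent, p.244, (2.18) p.257, Cor. 3 p.264; Balaban1989LargeFieldI, (0.2)–(0.3) p.176] -/
theorem b16_main_at_recordV₁₃_of_uvRowV (hC : w.C = (datumOfRecord₁₃SepCoPHV F N θ h v).C) (hup : w.up P = upOfRecord₅C F N (θ.toStage5₁₃CoPH F N) P)
    (hR13 : ∀ k, k < P.K → TLaw₁₃CoPH F N θ P k → SLaw₁₃CoPH F N θ P (k + 1)) {γ₁ : ℝ} (hγ : w.γ ≤ γ₁)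
    (hUVV : (genFlow (betaOfRecord₁₃ F N θ.toStage13Params) P.g0).InInterval γ₁ P.K → ∀ k, k ≤ P.K → SLaw₁₃CoPH F N θ P k →
      ∀ U : GaugeField (F.P P.K) k (SU N),
        chiβOfRecord₁₃ F N θ.toStage13Params P.K (gOfRecord₁₃ F N θ.toStage13Params P) k U *
              Real.exp (-(1 / (gOfRecord₁₃ F N θ.toStage13Params P k) ^ 2 * wilsonBGOfRecord F N θ.εbg P k U)
                - w.em (gOfRecord₁₃ F N θ.toStage13Params P k) * (Fintype.card (Site (F.P P.K) k) : ℝ)) ≤ v.ρ P k U ∧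
        v.ρ P k U ≤ Real.exp (w.ep (gOfRecord₁₃ F N θ.toStage13Params P k) * (Fintype.card (Site (F.P P.K) k) : ℝ))) :
    Dag.B16_main (leavesP w P) := by
  have hR : (w.up P).rOperation := by
    have := (rOperation_iff_laws₁₃CoPH F N θ w P hup).2 hR13
    exact this
  exact b16_main_of_rOperation_of_uvSlot w P hR
    (uvSlot_at_construction F N (coreOfRecord₁₃CoPH F N θ) v.ρ w P (Rep := fun _ => Unit) (fun _ => ()) (fun k _ => SLaw₁₃CoPH F N θ P k) (fun k _ => v.ρ P k)
      (hC.trans (datumOfRecord₁₃SepCoPHV_C F N θ h v)) (fun _ => rfl) (fun k _ hs => (sect2Form_coreOfRecord₁₃CoPH_iff F N θ P k).1 hs) hγ hUVV)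

end Node

/-! ## §3. ★★★ … from `B16.Cor3With` at the revised datum; the slot letter's body yields the world letters -/

section Slot

variable (θ : Stage13HParams F N) (h : θ.Provisos₁₃SepCoPH F N) (v : Revision₁₃ F N θ h)

/-- **★★★ N13 AT THE REVISED-RECORD WORLD FROM [III] COR. 3 «WITH e±» AT THE REVISED DATUM**: `B16.Cor3With (datumOfRecord₁₃SepCoPHV F N θ h v).C γ₁ w.em w.ep` (the Cor-3 conjunct of the slot
letter's body, with the world's dependence functions) + the bindings + (R₁₃) + `w.γ ≤ γ₁` ⟹ `Dag.B16_main (leavesP w P)`.  The `SLaw` guard of §2 is not even used (Cor. 3 «with e±» is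
unguarded).  HYPOTHESES displayed; count-neutral. [cite: Balaban1989LargeFieldII, Thm 1 p.355, (0.1) pp.355–356, p.387; Balaban1988Convergent, Cor. 3 (2.50) p.264] -/
theorem b16_main_at_recordV₁₃_of_cor3With (w : WorldP) (P : B12.RunParams) (hC : w.C = (datumOfRecord₁₃SepCoPHV F N θ h v).C)
    (hup : w.up P = upOfRecord₅C F N (θ.toStage5₁₃CoPH F N) P) (hR13 : ∀ k, k < P.K → TLaw₁₃CoPH F N θ P k → SLaw₁₃CoPH F N θ P (k + 1))
    {γ₁ : ℝ} (hγ : w.γ ≤ γ₁) (hcor : B16.Cor3With (datumOfRecord₁₃SepCoPHV F N θ h v).C γ₁ w.em w.ep) :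
    Dag.B16_main (leavesP w P) :=
  b16_main_at_recordV₁₃_of_uvRowV F N θ h v w P hC hup hR13 hγ fun hP k hk _ U =>
    (uvIneq_revision₁₃_iff F N θ h v P k U _ _).1 (hcor P ((flow_inInterval_revision₁₃_iff F N θ h v P γ₁).2 hP) k hk U)

/-- **★★★ THE SLOT LETTER'S BODY YIELDS THE WORLD LETTERS FOR N13.**  From `B16.EndStatementBPrinted (datumOfRecord₁₃SepCoPHV F N θ h v).C` (= Theorem 1 ∧ `Cor3_250` there — the body of
the K1⁹ (B)-slot letter `∃ v, …`): there are `γ₁ > 0` and dependence functions `em ep` such that at EVERY run `P` and EVERY world `w` bound to the revised datum (`w.C = (datumⱽ v).C`,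
`w.up P = upOfRecord₅C …`) with the 𝐑-leaf's (R₁₃) laws and the letters `w.γ ≤ γ₁`, `w.em = em`, `w.ep = ep`, N13's node `Dag.B16_main (leavesP w P)` holds.  This is the form a
stub-1 engine consumes: build the `RecordS`-type world with these letters from the slot witness.  HYPOTHESES displayed; count-neutral; N13 NOT discharged.
[cite: Balaban1989LargeFieldII, Thm 1 p.355, (0.1) pp.355–356, p.387, p.391; Balaban1988Convergent, Cor. 3 (2.50) p.264] -/
theorem exists_letters_b16_main_at_recordV₁₃_of_endStatementBPrinted (hB : B16.EndStatementBPrinted (datumOfRecord₁₃SepCoPHV F N θ h v).C) :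
    ∃ γ₁ : ℝ, 0 < γ₁ ∧ ∃ em ep : ℝ → ℝ, ∀ (w : WorldP) (P : B12.RunParams), w.C = (datumOfRecord₁₃SepCoPHV F N θ h v).C →
      w.up P = upOfRecord₅C F N (θ.toStage5₁₃CoPH F N) P → (∀ k, k < P.K → TLaw₁₃CoPH F N θ P k → SLaw₁₃CoPH F N θ P (k + 1)) →
      w.γ ≤ γ₁ → w.em = em → w.ep = ep → Dag.B16_main (leavesP w P) := by
  obtain ⟨-, γ₁, hγ₁, em, ep, hcor⟩ := hB
  refine ⟨γ₁, hγ₁, em, ep, fun w P hC hup hR13 hγ hem hep => ?_⟩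
  refine b16_main_at_recordV₁₃_of_cor3With F N θ h v w P hC hup hR13 hγ ?_
  rw [hem, hep]
  exact hcor

end Slot

/-! ## §4. ★★★ END-TO-END on the measure road: Theorem 1 + the level-0 row + ONE measure inequality + the a.e. (Lˢ) half ⟹ a slot witness AND N13's node at every world bound to it -/

section EndToEnd

variable (θ : Stage13HParams F N) (h : θ.Provisos₁₃SepCoPH F N)

open ExpMeanLog (deltaSU)
open Summit.QuantumFields.YangMills.BalabanUVNodes.N13AERowOfAveragedGibbsMeasureBoundAtRecord13SepCoPH
  (exists_revision₁₃_endStatementBPrinted_of_thm1_of_row0_of_towerMeasureUV_of_aeLowerSmall)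

open Classical in
/-- **★★★ N13's NODE AT THE REVISED RECORD, END-TO-END FROM THIS SEAT's MEASURE ROAD.**  Theorem 1 at K1's literal datum, the level-0 row `hrow0`, the tree's selector laws (i)(ii), the
MEASURE INEQUALITY `hμUV` «`(π_{k+1})_*(ρ₀·dU_0)(S) ≤ ofReal (e^{ep(g_{k+1})|T₁^{(k+1)}|}) · Haar_{k+1}(S)`» on the γ-windowed runs' levels `k+1 ≤ K` (ultraviolet stability of the BLOCK-AVERAGED
WILSON–GIBBS MEASURE — no density version), dag-n13-w2's a.e. (Lˢ) letter `hlowerSmall` and `εreg` in [Av] Prop. 2's range ⟹ a slot witness `v : Revision₁₃ F N θ h` together with letters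
`γ₁ > 0`, `em′`, `ep′` such that N13's node holds at EVERY (R₁₃)-world bound to `datumOfRecord₁₃SepCoPHV F N θ h v` with `w.γ ≤ γ₁`, `w.em = em′`, `w.ep = ep′` (p622818 §3 ∘ §3).
DISPLAYED (LOCATED): `hμUV` = (2.50)'s upper half for the unrenormalised averaged measure (Bałaban's theorem proper at the tree's selector laws); `hrow0` (n13-w1's level-0 editions at the
K0-class witnesses); (Lˢ) ([III] Thm 2 at the all-small history); Theorem 1 (N11's T-row + selector laws, p583899).  Nothing of Bałaban's asserted; N13 NOT discharged; K1⁸∕K1⁹ NEITHER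
proved NOR refuted. [cite: Balaban1989LargeFieldII, Thm 1 p.355, (0.1) pp.355–356, p.387; Balaban1988Convergent, Thm 1 p.262, Thm 2 p.263, (2.49)–(2.50) p.264, (3.1) p.264; Balaban1989LargeFieldI, (0.2)–(0.4) p.176, (i)–(ii) p.177] -/
theorem exists_revision₁₃_letters_b16_main_of_thm1_of_row0_of_towerMeasureUV_of_aeLowerSmall (hε : 0 < θ.ν.εreg)
    (hε3 : (143 * ((((4 + 4 : ℕ) : ℝ)) ^ 2 / 4) ^ 2) * θ.ν.εreg ≤ 1 / 3) (hε2 : 2 * θ.ν.εreg ≤ 2 * deltaSU (Fin N) / ((((4 + 4) * F.L : ℕ) : ℝ) ^ 2))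
    (h1 : B16.Thm1Printed (datumOfRecord₁₃SepCoPH F N θ h).C) {γ : ℝ} (hγ : 0 < γ) {em ep : ℝ → ℝ}
    (hidem : ∀ (P : B12.RunParams) k, k < P.K → ∀ a, θ.ppSel P (gOfRecord₁₃ F N θ.toStage13Params P) (k + 1) (θ.ppSel P (gOfRecord₁₃ F N θ.toStage13Params P) (k + 1) a)
      = θ.ppSel P (gOfRecord₁₃ F N θ.toStage13Params P) (k + 1) a)
    (hdead : ∀ (P : B12.RunParams) j, j < P.K → ∀ a : SeqOfRecord F θ.ν θ.τ9.M (gOfRecord₁₃ F N θ.toStage13Params P) P.K (j + 1),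
      θ.ppSel P (gOfRecord₁₃ F N θ.toStage13Params P) (j + 1) a ≠ a →
      ∀ V, B15.BasicStep.fibreIntegral (fibOfSeq F θ.ν θ.τ9 P (gOfRecord₁₃ F N θ.toStage13Params P) (j + 1) a)
        (rterm (sliceOfRecord F N θ.ν θ.τ9.M P (gOfRecord₁₃ F N θ.toStage13Params P) (j + 1)
          (slotsTOfRecord F N θ.ν θ.τ9 (EOfRecord₁₃ F N θ.toStage13Params) (wOfRecord₉ F N θ.toStage9Params) θ.ppSel P (gOfRecord₁₃ F N θ.toStage13Params P) (j + 1))) a) V = 0)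
    (hrow0 : ∀ P : B12.RunParams, ((datumOfRecord₁₃SepCoPH F N θ h).C P).flow.InInterval γ P.K → SLaw₁₃CoPH F N θ P 0 →
      ∀ U : GaugeField (F.P P.K) 0 (SU N),
        chiβOfRecord₁₃ F N θ.toStage13Params P.K (gOfRecord₁₃ F N θ.toStage13Params P) 0 U *
              Real.exp (-(1 / (gOfRecord₁₃ F N θ.toStage13Params P 0) ^ 2 * wilsonBGOfRecord F N θ.εbg P 0 U)
                - em (gOfRecord₁₃ F N θ.toStage13Params P 0) * (Fintype.card (Site (F.P P.K) 0) : ℝ)) ≤ densOfRecord₁₃ F N θ.toStage13Params P 0 U ∧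
          densOfRecord₁₃ F N θ.toStage13Params P 0 U ≤ Real.exp (ep (gOfRecord₁₃ F N θ.toStage13Params P 0) * (Fintype.card (Site (F.P P.K) 0) : ℝ)))
    (hμUV : ∀ P : B12.RunParams, ((datumOfRecord₁₃SepCoPH F N θ h).C P).flow.InInterval γ P.K → ∀ k, k + 1 ≤ P.K → ∀ S : Set (GaugeField (F.P P.K) (k + 1) (SU N)), MeasurableSet S →
      ((fieldMeasure (F.P P.K) 0 (SU N)).withDensity fun U =>
          ENNReal.ofReal (rhoZeroOfRecord F N P.K (gOfRecord₁₃ F N θ.toStage13Params P 0) (EOfRecord₁₃ F N θ.toStage13Params P) U)).map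
        (Nat.rec (motive := fun j => GaugeField (F.P P.K) 0 (SU N) → GaugeField (F.P P.K) j (SU N)) id (fun j π => (avOfRecord F N P.K j).avg ∘ π) (k + 1)) S ≤
      ENNReal.ofReal (Real.exp (ep (gOfRecord₁₃ F N θ.toStage13Params P (k + 1)) * (Fintype.card (Site (F.P P.K) (k + 1)) : ℝ))) * fieldMeasure (F.P P.K) (k + 1) (SU N) S)
    (hlowerSmall : ∀ P : B12.RunParams, ((datumOfRecord₁₃SepCoPH F N θ h).C P).flow.InInterval γ P.K → ∀ k, k + 1 ≤ P.K → SLaw₁₃CoPH F N θ P (k + 1) →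
      ∀ᵐ U ∂(fieldMeasure (F.P P.K) (k + 1) (SU N)),
        (∀ p : Plaq (F.P P.K) (k + 1), ¬ IsB0 (F := F) (⟨p.src, p.μ⟩ : PBond (F.P P.K) (k + 1)) → ¬ IsB0 (F := F) (⟨p.src.shift p.μ, p.ν⟩ : PBond (F.P P.K) (k + 1)) →
          ¬ IsB0 (F := F) (⟨p.src.shift p.ν, p.μ⟩ : PBond (F.P P.K) (k + 1)) → ¬ IsB0 (F := F) (⟨p.src, p.ν⟩ : PBond (F.P P.K) (k + 1)) →
          dist1 (GaugeField.plaqHol U p) < 2 * θ.ν.εreg + 4 * θ.ε₂₉) →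
        chiβOfRecord₁₃ F N θ.toStage13Params P.K (gOfRecord₁₃ F N θ.toStage13Params P) (k + 1) U *
            Real.exp (-(1 / (gOfRecord₁₃ F N θ.toStage13Params P (k + 1)) ^ 2 * wilsonBGOfRecord F N θ.εbg P (k + 1) U)
              - em (gOfRecord₁₃ F N θ.toStage13Params P (k + 1)) * (Fintype.card (Site (F.P P.K) (k + 1)) : ℝ)) ≤ densOfRecord₁₃ F N θ.toStage13Params P (k + 1) U) :
    ∃ (v : Revision₁₃ F N θ h) (γ₁ : ℝ), 0 < γ₁ ∧ ∃ em' ep' : ℝ → ℝ, ∀ (w : WorldP) (P : B12.RunParams), w.C = (datumOfRecord₁₃SepCoPHV F N θ h v).C →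
      w.up P = upOfRecord₅C F N (θ.toStage5₁₃CoPH F N) P → (∀ k, k < P.K → TLaw₁₃CoPH F N θ P k → SLaw₁₃CoPH F N θ P (k + 1)) →
      w.γ ≤ γ₁ → w.em = em' → w.ep = ep' → Dag.B16_main (leavesP w P) := by
  obtain ⟨v, hB⟩ := exists_revision₁₃_endStatementBPrinted_of_thm1_of_row0_of_towerMeasureUV_of_aeLowerSmall F N θ h hε hε3 hε2 h1 hγ hidem hdead hrow0 hμUV hlowerSmall
  obtain ⟨γ₁, hγ₁, em', ep', hnode⟩ := exists_letters_b16_main_at_recordV₁₃_of_endStatementBPrinted F N θ h v hB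
  exact ⟨v, γ₁, hγ₁, em', ep', hnode⟩

end EndToEnd

/-! ## §5. ★★★ THE THIRTEEN NODES AT THE REVISED WORLD from the thirteen at the record-bound twin world + N13 at the revised world (only `B16_main` reads `uvBounds`) -/

section Transfer

/-- **ONLY N13 READS `uvBounds`** (kernel census of `Dag.B4_main … B16_main`, by `rfl` on the structure update): the thirteen node predicates at a leaf tuple with its `uvBounds` slot
replaced ⟸ the thirteen at the original tuple, except `B16_main`, which is re-supplied. [cite: Balaban1989LargeFieldII, Thm 1 p.355 (bookkeeping)] -/
theorem nodes_update_uvBounds (ℓ : Dag.Leaves) (X : Prop) (hn : Nodes ℓ) (h16 : Dag.B16_main { ℓ with uvBounds := X }) : Nodes { ℓ with uvBounds := X } := by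
  obtain ⟨h4, h5, h6, h7, h8, h9, h10, h11, h12, h13, h14, h15, -⟩ := hn
  exact ⟨h4, h5, h6, h7, h8, h9, h10, h11, h12, h13, h14, h15, h16⟩

variable (θ : Stage13HParams F N) (h : θ.Provisos₁₃SepCoPH F N) (v : Revision₁₃ F N θ h) (w : WorldP) (P : B12.RunParams)

/-- **★★★ ALL THIRTEEN NODES AT THE REVISED-RECORD WORLD ⟸ the thirteen at the SAME world re-bound to the record datum (any proof — e.g. the K1 engines') + N13 at the revised world (§2–§4).**
`leavesP_revision₁₃_eq_update` + `nodes_update_uvBounds`.  So re-cutting stub 1's world to the slot costs exactly ONE node, N13, whose revised-world knit is §2.  HYPOTHESES displayed; no node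
discharged; count-neutral. [cite: Balaban1989LargeFieldII, Thm 1 p.355, (0.1) pp.355–356 (bookkeeping)] -/
theorem nodes_at_recordV₁₃_of_nodes_rebound_of_b16 (hC : w.C = (datumOfRecord₁₃SepCoPHV F N θ h v).C)
    (hnodes : Nodes (leavesP { w with C := (datumOfRecord₁₃SepCoPH F N θ h).C } P)) (h16 : Dag.B16_main (leavesP w P)) :
    Nodes (leavesP w P) := by
  rw [leavesP_revision₁₃_eq_update F N θ h v w P hC] at h16 ⊢
  exact nodes_update_uvBounds _ _ hnodes h16

/-- **★★★ … with N13 supplied by the slot letter's body at matching world letters**: `B16.Cor3With (datumⱽ v).C γ₁ w.em w.ep`, `w.γ ≤ γ₁`, the up-binding and (R₁₃) at `P`, and the twelve-plus-one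
nodes at the record-rebound twin ⟹ `Nodes (leavesP w P)` at the revised world. [cite: Balaban1989LargeFieldII, Thm 1 p.355, (0.1) pp.355–356, p.387 (bookkeeping)] -/
theorem nodes_at_recordV₁₃_of_nodes_rebound_of_cor3With (hC : w.C = (datumOfRecord₁₃SepCoPHV F N θ h v).C)
    (hup : w.up P = upOfRecord₅C F N (θ.toStage5₁₃CoPH F N) P) (hR13 : ∀ k, k < P.K → TLaw₁₃CoPH F N θ P k → SLaw₁₃CoPH F N θ P (k + 1))
    {γ₁ : ℝ} (hγ : w.γ ≤ γ₁) (hcor : B16.Cor3With (datumOfRecord₁₃SepCoPHV F N θ h v).C γ₁ w.em w.ep)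
    (hnodes : Nodes (leavesP { w with C := (datumOfRecord₁₃SepCoPH F N θ h).C } P)) :
    Nodes (leavesP w P) :=
  nodes_at_recordV₁₃_of_nodes_rebound_of_b16 F N θ h v w P hC hnodes (b16_main_at_recordV₁₃_of_cor3With F N θ h v w P hC hup hR13 hγ hcor)

end Transfer

end Summit.QuantumFields.YangMills.BalabanUVNodes.N13NodeAtRevisedRecordWorldAtRecord13SepCoPHV

end
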